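import Literature.MathematicalPhysics.QuantumFieldTheory.Balaban1983to89.Node00.Record13SepCoPRInhabitedOfSepCoP
import Literature.MathematicalPhysics.QuantumFieldTheory.Balaban1983to89.Node00.Record13SepCoPInhabitedOfThm1CoP7M
import Literature.MathematicalPhysics.QuantumFieldTheory.Balaban1983to89.Node00.Record13SepCoPInhabitedOfThm1CoP7MC1

/-!
# NODE 00 — STAGE 13, v1.6 `CoPR`: the POINTED COROLLARIES of `Record13SepCoPRInhabitedOfSepCoP` over node00-def-K0a's v1.5 socket 16a and closers 16b∕16c∕16d (`N = 2`; cured witness)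

Cell `pub-ymgap`, YM-PLAN Track A.  This leaf module carries VERBATIM (same names, same namespace, same proofs) the former §4 of seat `pub-ymgap-node00-def-K0a`'s FILE 18
`Node00/Record13SepCoPRInhabitedOfSepCoP`: `exists_k0SepCoPR_of_bgSepCoP_theta13LiveOfNumerics` (16a socket lifted along ★★★ `exists_k0SepCoPR_of_exists_k0SepCoP`), `exists_k0SepCoPR_of_classBounds`
(16b Cut A), `exists_k0SepCoPR_of_thm1RegSepCoP7M_of_betaBox` (16c Cut B′), `exists_k0SepCoPR_of_thm1RegSepCoP7M_of_thm1C1_of_betaBox` (16d Cut B″).  WHY A SEPARATE MODULE (Stage 2,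
director-ym №343∕№346, import hygiene only): these four one-liners are the ONLY consumers of `Record13SepCoPInhabitedOfThm1CoP7M(C1)` in FILE 18, while FILE 18's §1–§3 (`Stage13RParams.ofCured`, …) are
imported by every at-record reader (N19∕N20∕N21∕N27 …); keeping them apart keeps those readers out of the `Record13CoP` seam edit's red cone.  Nothing is re-proved or re-stated.

HONEST FRAMING.  Structure bookkeeping moved between modules; the displayed hypotheses are 16a–16d's VERBATIM (named [Balaban1985Variational] facts NEVER asserted); nothing of Bałaban asserted or
discharged; K0⁶∕K0⁷ NOT closed; counts unmoved; one finite 𝕋⁴ programme at fixed ε — NOT continuum ∕ OS ∕ mass gap ∕ Clay.  No `sorry`, `axiom`, `instance`, `notation`.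

STAGE-2 RE-KEY (2026-08-30; (E1) variant (iii-b) of record, director-ym №343 (D5)∕(D6), №345, №350; seat node00-def-K0a g10): «(E1) Stage-2 coherence re-key to print's (2.3) datum (FLAG №16 ∕ LOCATE-HSEAM 5d3298b8d191f169); the (b)-keyed text survives in git history».  After the `Record13CoP` seam re-point `UbgOfRecord₁₃CoP (n+1) = UbgMSCoPOfRecordB …` (node00-def-R) THIS LEAF IS BORN RE-KEYED (director-ym №351 S2-HOIST ∕ №355 (L2); hoist located by dag-n27-c g25, import head certified by dag-n07-w2 g7 ∕ RR-2 g24): the socket corollary is the former §4's text VERBATIM; the three closer-keyed corollaries take the re-keyed hypotheses of 16b∕16c∕16d READ AT PRINT's (2.3) DATUM — clause tokens `solvableDomB … (lamBondsSeq s.Ω n)` ∕ `UbgMSCoPOfRecordB` (node00-def-R S2b ∕ linchpin), (8) `VariationalThm1RegSepCoP7MGB F 2 Adm (lamDatum F) (dataSmall7PTopOf F 2) B₃ a₀ a₁` (k0-s1-w1 S1a-C), (9)–(10) `VariationalThm1C1RegSepCoP7MGB F 2 Adm (lamDatum F) (dataSmall7PTopOf F 2) B₃ B₃' a₀ a₁`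 (node00-def-K0a `Record12BgRowCoClassC1B`), guard discharge `hAdm` (w1's all-torus shape at `θ₁₅ᶜᶜ¹`) — and pass them positionally as before; the (b)-keyed §4 survives in FILE 18's git history.

-/

noncomputable section

open MeasureTheory
open scoped BigOperators Matrix.Norms.L2Operator

namespace Literature.MathematicalPhysics.QuantumFieldTheory.Balaban1983to89.Node00

open T4Continuum B14.Eq218Concrete B15DeterminingSets B15DeterminingSetsB FlowStep FlowStepRuns B12RegularSpaces111 B14RegularSpaces234 B14Radii T4AxialGaugeSmallField

/-! ## §4. Pointed corollaries over node00-def-K0a's v1.5 socket and closers (`N = 2`; cured witness) -/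

section Pointed

variable {ε₀ ε₂₉ B₃ B₃' a₀ a₁ : ℝ}

/-- **★★★ THE ⁶ SOCKET** — the v1.6 K0 body for `F` at `N = 2` at ANY numerics from `n.Pos`, `0 < ε₂₉`, the two pins and THE (7)-GUARDED SEPARATED ROW P11 AT THE Co CARRIER at the all-numerics family ALONE (16a's socket lifted along ★★★; cured witness `⟨θ₁₃(n, ε₂₉), ZrOfRecord₁₃ …⟩`).  A REDUCTION — NOT a discharge. [cite: Balaban1988Convergent, Thm 1 p.262, (1.11) p.248, (2.12) p.256, (2.28) p.259, (3.16)–(3.22) pp.268–269; Balaban1985RegularSpaces, (1.3)–(1.9) p.77; Balaban1985Variational, (6)–(7) p.278, Thm 1 (8)–(10) p.279; Balaban1989LargeFieldI, (0.3)–(0.4) p.176] -/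
theorem exists_k0SepCoPR_of_bgSepCoP_theta13LiveOfNumerics (F : T4Family) {n : Stage12Numerics} {ε₂₉ : ℝ} (hn : n.Pos) (hε' : 0 < ε₂₉) (hM : ∃ a : ℕ, n.τ9.M = F.L ^ a) (hM₁ : n.ν.M₁ ∣ n.τ9.M)
    (hbgSepCoP : ∀ (p : B12.RunParams) (m : ℕ), m ≤ p.K → Step.InInterval (theta13LiveOfNumerics F 2 n ε₂₉ (zeta316OfRecord F 2 n.ν n.τ9.M n.A₁) (RzOfRecord F 2) (ZtOfRecord F 2)).γ m (gOfRecord₁₃ F 2 (theta13LiveOfNumerics F 2 n ε₂₉ (zeta316OfRecord F 2 n.ν n.τ9.M n.A₁) (RzOfRecord F 2) (ZtOfRecord F 2)) p) → PartCompat₁₃ F 2 (theta13LiveOfNumerics F 2 n ε₂₉ (zeta316OfRecord F 2 n.ν n.τ9.M n.A₁) (RzOfRecord F 2) (ZtOfRecord F 2)) p m →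
      ∀ s : SeqOfRecord F (theta13LiveOfNumerics F 2 n ε₂₉ (zeta316OfRecord F 2 n.ν n.τ9.M n.A₁) (RzOfRecord F 2) (ZtOfRecord F 2)).ν (theta13LiveOfNumerics F 2 n ε₂₉ (zeta316OfRecord F 2 n.ν n.τ9.M n.A₁) (RzOfRecord F 2) (ZtOfRecord F 2)).τ9.M (gOfRecord₁₃ F 2 (theta13LiveOfNumerics F 2 n ε₂₉ (zeta316OfRecord F 2 n.ν n.τ9.M n.A₁) (RzOfRecord F 2) (ZtOfRecord F 2)) p) p.K m, Sect2.SeqSeparated (theta13LiveOfNumerics F 2 n ε₂₉ (zeta316OfRecord F 2 n.ν n.τ9.M n.A₁) (RzOfRecord F 2) (ZtOfRecord F 2)).ν.M₁ s →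
      ∀ W : MSField (F.P p.K) (SU 2), W ∈ suppOfRecord₁₃P F 2 (theta13LiveOfNumerics F 2 n ε₂₉ (zeta316OfRecord F 2 n.ν n.τ9.M n.A₁) (RzOfRecord F 2) (ZtOfRecord F 2)) p m s →
      Sect2.DataSmall7PTop (avOfRecord F 2 p.K) s.Ω (suppDomOfRecord F (theta13LiveOfNumerics F 2 n ε₂₉ (zeta316OfRecord F 2 n.ν n.τ9.M n.A₁) (RzOfRecord F 2) (ZtOfRecord F 2)).ν p.K s.Ω) m (fun j => (theta13LiveOfNumerics F 2 n ε₂₉ (zeta316OfRecord F 2 n.ν n.τ9.M n.A₁) (RzOfRecord F 2) (ZtOfRecord F 2)).s2.cR * epsOfRecord (theta13LiveOfNumerics F 2 n ε₂₉ (zeta316OfRecord F 2 n.ν n.τ9.M n.A₁) (RzOfRecord F 2) (ZtOfRecord F 2)).ν (gOfRecord₁₃ F 2 (theta13LiveOfNumerics F 2 n ε₂₉ (zeta316OfRecord F 2 n.ν n.τ9.M n.A₁) (RzOfRecord F 2) (ZtOfRecord F 2)) p) j) W →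
      ∀ j, 1 ≤ j → j ≤ m → ∀ X : (Sect2.domSys (F.P p.K) (theta13LiveOfNumerics F 2 n ε₂₉ (zeta316OfRecord F 2 n.ν n.τ9.M n.A₁) (RzOfRecord F 2) (ZtOfRecord F 2)).τ9.M j).Dom,
      (Sect2.domSites (F.P p.K) (theta13LiveOfNumerics F 2 n ε₂₉ (zeta316OfRecord F 2 n.ν n.τ9.M n.A₁) (RzOfRecord F 2) (ZtOfRecord F 2)).τ9.M j X ⊆ s.Λ j →
        Sect2.ofBackgroundC (settingOfRecord₁₃ F 2 (theta13LiveOfNumerics F 2 n ε₂₉ (zeta316OfRecord F 2 n.ν n.τ9.M n.A₁) (RzOfRecord F 2) (ZtOfRecord F 2)) p).ι (UbgOfRecord₁₃CoP F 2 (theta13LiveOfNumerics F 2 n ε₂₉ (zeta316OfRecord F 2 n.ν n.τ9.M n.A₁) (RzOfRecord F 2) (ZtOfRecord F 2)) p m s W) ∈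
          Sect2.spaceI (settingOfRecord₁₃ F 2 (theta13LiveOfNumerics F 2 n ε₂₉ (zeta316OfRecord F 2 n.ν n.τ9.M n.A₁) (RzOfRecord F 2) (ZtOfRecord F 2)) p) ((theta13LiveOfNumerics F 2 n ε₂₉ (zeta316OfRecord F 2 n.ν n.τ9.M n.A₁) (RzOfRecord F 2) (ZtOfRecord F 2)).Rz p.K) (theta13LiveOfNumerics F 2 n ε₂₉ (zeta316OfRecord F 2 n.ν n.τ9.M n.A₁) (RzOfRecord F 2) (ZtOfRecord F 2)).τ9.M j (Sect2.domSites (F.P p.K) (theta13LiveOfNumerics F 2 n ε₂₉ (zeta316OfRecord F 2 n.ν n.τ9.M n.A₁) (RzOfRecord F 2) (ZtOfRecord F 2)).τ9.M j X)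
            ((settingOfRecord₁₃ F 2 (theta13LiveOfNumerics F 2 n ε₂₉ (zeta316OfRecord F 2 n.ν n.τ9.M n.A₁) (RzOfRecord F 2) (ZtOfRecord F 2)) p).lf.alpha0 ((settingOfRecord₁₃ F 2 (theta13LiveOfNumerics F 2 n ε₂₉ (zeta316OfRecord F 2 n.ν n.τ9.M n.A₁) (RzOfRecord F 2) (ZtOfRecord F 2)) p).flow.g j)) ((settingOfRecord₁₃ F 2 (theta13LiveOfNumerics F 2 n ε₂₉ (zeta316OfRecord F 2 n.ν n.τ9.M n.A₁) (RzOfRecord F 2) (ZtOfRecord F 2)) p).lf.alpha1 ((settingOfRecord₁₃ F 2 (theta13LiveOfNumerics F 2 n ε₂₉ (zeta316OfRecord F 2 n.ν n.τ9.M n.A₁) (RzOfRecord F 2) (ZtOfRecord F 2)) p).flow.g j))) ∧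
      (Sect2.admB (F.P p.K) (theta13LiveOfNumerics F 2 n ε₂₉ (zeta316OfRecord F 2 n.ν n.τ9.M n.A₁) (RzOfRecord F 2) (ZtOfRecord F 2)).ν (theta13LiveOfNumerics F 2 n ε₂₉ (zeta316OfRecord F 2 n.ν n.τ9.M n.A₁) (RzOfRecord F 2) (ZtOfRecord F 2)).τ9.M (gOfRecord₁₃ F 2 (theta13LiveOfNumerics F 2 n ε₂₉ (zeta316OfRecord F 2 n.ν n.τ9.M n.A₁) (RzOfRecord F 2) (ZtOfRecord F 2)) p) s.Ω s.Λ j (Sect2.domSites (F.P p.K) (theta13LiveOfNumerics F 2 n ε₂₉ (zeta316OfRecord F 2 n.ν n.τ9.M n.A₁) (RzOfRecord F 2) (ZtOfRecord F 2)).τ9.M j X) = true →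
        Sect2.ofBackgroundC (settingOfRecord₁₃ F 2 (theta13LiveOfNumerics F 2 n ε₂₉ (zeta316OfRecord F 2 n.ν n.τ9.M n.A₁) (RzOfRecord F 2) (ZtOfRecord F 2)) p).ι (UbgOfRecord₁₃CoP F 2 (theta13LiveOfNumerics F 2 n ε₂₉ (zeta316OfRecord F 2 n.ν n.τ9.M n.A₁) (RzOfRecord F 2) (ZtOfRecord F 2)) p m s W) ∈
          Sect2.spaceMS (settingOfRecord₁₃ F 2 (theta13LiveOfNumerics F 2 n ε₂₉ (zeta316OfRecord F 2 n.ν n.τ9.M n.A₁) (RzOfRecord F 2) (ZtOfRecord F 2)) p) ((theta13LiveOfNumerics F 2 n ε₂₉ (zeta316OfRecord F 2 n.ν n.τ9.M n.A₁) (RzOfRecord F 2) (ZtOfRecord F 2)).Rz p.K) (theta13LiveOfNumerics F 2 n ε₂₉ (zeta316OfRecord F 2 n.ν n.τ9.M n.A₁) (RzOfRecord F 2) (ZtOfRecord F 2)).τ9.M j (Sect2.domSites (F.P p.K) (theta13LiveOfNumerics F 2 n ε₂₉ (zeta316OfRecord F 2 n.ν n.τ9.M n.A₁) (RzOfRecord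 F 2) (ZtOfRecord F 2)).τ9.M j X) s.Ω)) :
    ∃ θ : Stage13RParams F 2, θ.Provisos₁₃SepCoPR F 2 ∧ (θ.ZrUnity F 2 ∧ θ.SlotsNondegenerate₁₃ F 2) ∧ θ.Admissible F 2 :=
  exists_k0SepCoPR_of_exists_k0SepCoP F (exists_k0SepCoP_of_bgSepCoP_theta13LiveOfNumerics F hn hε' hM hM₁ hbgSepCoP)

/-- **★★★★ CUT A AT ⁶, AT PRINT's (2.3) DATUM** — the v1.6 K0 body for `F` from the per-datum CLASS BOUNDS at `θ₁₅ᶜᶜ¹` read at node00-def-R's print-datum background `UbgMSCoPOfRecordB` on the solvable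
set `solvableDomB … (lamBondsSeq s.Ω n)` (16b's Stage-2 re-key, node00-def-R, lifted along the trunk's ★★★; cured witness).  CONDITIONAL — nothing of Bałaban asserted. [cite: Balaban1988Convergent, Thm 1 p.262, (1.11) p.248, (2.12)–(2.13) p.256, (2.28) p.259, (3.16)–(3.22) pp.268–269; Balaban1985RegularSpaces, (1.3)–(1.9) p.77; Balaban1985Variational, (6)–(7) p.278, Thm 1 (8)–(10) p.279, p.304 lines 1–2; Balaban1984PropagatorsII, (2.3) p.224; Balaban1989LargeFieldI, (0.3)–(0.4) p.176] -/
theorem exists_k0SepCoPR_of_classBounds (F : T4Family) (hε : 0 < ε₀) (hε' : 0 < ε₂₉) (hB : 0 ≤ B₃) (hB' : 0 ≤ B₃') (ha₀ : 0 < a₀) (ha₁ : 0 < a₁)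
    (hclass : ∀ (p : B12.RunParams) (n : ℕ), n ≤ p.K → Step.InInterval (theta13OfThm1CC1 F 2 ε₀ ε₂₉ B₃ B₃' a₀ a₁).γ n (gOfRecord₁₃ F 2 (theta13OfThm1CC1 F 2 ε₀ ε₂₉ B₃ B₃' a₀ a₁) p) → PartCompat₁₃ F 2 (theta13OfThm1CC1 F 2 ε₀ ε₂₉ B₃ B₃' a₀ a₁) p n →
      ∀ s : SeqOfRecord F (theta13OfThm1CC1 F 2 ε₀ ε₂₉ B₃ B₃' a₀ a₁).ν (theta13OfThm1CC1 F 2 ε₀ ε₂₉ B₃ B₃' a₀ a₁).τ9.M (gOfRecord₁₃ F 2 (theta13OfThm1CC1 F 2 ε₀ ε₂₉ B₃ B₃' a₀ a₁) p) p.K n, Sect2.SeqSeparated (theta13OfThm1CC1 F 2 ε₀ ε₂₉ B₃ B₃' a₀ a₁).ν.M₁ s → ∀ W : MSField (F.P p.K) (SU 2),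
      W ∈ suppOfRecord₁₃P F 2 (theta13OfThm1CC1 F 2 ε₀ ε₂₉ B₃ B₃' a₀ a₁) p n s → Sect2.DataSmall7PTop (avOfRecord F 2 p.K) s.Ω (suppDomOfRecord F (theta13OfThm1CC1 F 2 ε₀ ε₂₉ B₃ B₃' a₀ a₁).ν p.K s.Ω) n (fun j => (theta13OfThm1CC1 F 2 ε₀ ε₂₉ B₃ B₃' a₀ a₁).s2.cR * epsOfRecord (theta13OfThm1CC1 F 2 ε₀ ε₂₉ B₃ B₃' a₀ a₁).ν (gOfRecord₁₃ F 2 (theta13OfThm1CC1 F 2 ε₀ ε₂₉ B₃ B₃' a₀ a₁) p) j) W →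
      W ∈ solvableDomB (avOfRecord F 2 p.K) (regMSCoPOfRecord F 2 (theta13OfThm1CC1 F 2 ε₀ ε₂₉ B₃ B₃' a₀ a₁).ν p.K n s.Ω) (lamBondsSeq s.Ω n) →
      ∀ m, 1 ≤ m → m ≤ n → PlaqSmallOn (omegaPlaqs s.Ω m) (B₃ * ((theta13OfThm1CC1 F 2 ε₀ ε₂₉ B₃ B₃' a₀ a₁).s2.cR * epsOfRecord (theta13OfThm1CC1 F 2 ε₀ ε₂₉ B₃ B₃' a₀ a₁).ν (gOfRecord₁₃ F 2 (theta13OfThm1CC1 F 2 ε₀ ε₂₉ B₃ B₃' a₀ a₁) p) m) * (F.P p.K).eta m ^ 2)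
        (UbgMSCoPOfRecordB F 2 (theta13OfThm1CC1 F 2 ε₀ ε₂₉ B₃ B₃' a₀ a₁).ν (theta13OfThm1CC1 F 2 ε₀ ε₂₉ B₃ B₃' a₀ a₁).τ9.M (gOfRecord₁₃ F 2 (theta13OfThm1CC1 F 2 ε₀ ε₂₉ B₃ B₃' a₀ a₁) p) p.K n s W))
    (hclassC1 : ∀ (p : B12.RunParams) (n : ℕ), n ≤ p.K → Step.InInterval (theta13OfThm1CC1 F 2 ε₀ ε₂₉ B₃ B₃' a₀ a₁).γ n (gOfRecord₁₃ F 2 (theta13OfThm1CC1 F 2 ε₀ ε₂₉ B₃ B₃' a₀ a₁) p) → PartCompat₁₃ F 2 (theta13OfThm1CC1 F 2 ε₀ ε₂₉ B₃ B₃' a₀ a₁) p n →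
      ∀ s : SeqOfRecord F (theta13OfThm1CC1 F 2 ε₀ ε₂₉ B₃ B₃' a₀ a₁).ν (theta13OfThm1CC1 F 2 ε₀ ε₂₉ B₃ B₃' a₀ a₁).τ9.M (gOfRecord₁₃ F 2 (theta13OfThm1CC1 F 2 ε₀ ε₂₉ B₃ B₃' a₀ a₁) p) p.K n, Sect2.SeqSeparated (theta13OfThm1CC1 F 2 ε₀ ε₂₉ B₃ B₃' a₀ a₁).ν.M₁ s → ∀ W : MSField (F.P p.K) (SU 2),
      W ∈ suppOfRecord₁₃P F 2 (theta13OfThm1CC1 F 2 ε₀ ε₂₉ B₃ B₃' a₀ a₁) p n s → Sect2.DataSmall7PTop (avOfRecord F 2 p.K) s.Ω (suppDomOfRecord F (theta13OfThm1CC1 F 2 ε₀ ε₂₉ B₃ B₃' a₀ a₁).ν p.K s.Ω) n (fun j => (theta13OfThm1CC1 F 2 ε₀ ε₂₉ B₃ B₃' a₀ a₁).s2.cR * epsOfRecord (theta13OfThm1CC1 F 2 ε₀ ε₂₉ B₃ B₃' a₀ a₁).ν (gOfRecord₁₃ F 2 (theta13OfThm1CC1 F 2 ε₀ ε₂₉ B₃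 B₃' a₀ a₁) p) j) W →
      W ∈ solvableDomB (avOfRecord F 2 p.K) (regMSCoPOfRecord F 2 (theta13OfThm1CC1 F 2 ε₀ ε₂₉ B₃ B₃' a₀ a₁).ν p.K n s.Ω) (lamBondsSeq s.Ω n) →
      ∀ m, 1 ≤ m → m ≤ n → PlaqC1SmallOn (plaqInside (s.Ω m)) (B₃' * ((theta13OfThm1CC1 F 2 ε₀ ε₂₉ B₃ B₃' a₀ a₁).s2.cR * epsOfRecord (theta13OfThm1CC1 F 2 ε₀ ε₂₉ B₃ B₃' a₀ a₁).ν (gOfRecord₁₃ F 2 (theta13OfThm1CC1 F 2 ε₀ ε₂₉ B₃ B₃' a₀ a₁) p) m) * (F.P p.K).eta m ^ 3)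
        (UbgMSCoPOfRecordB F 2 (theta13OfThm1CC1 F 2 ε₀ ε₂₉ B₃ B₃' a₀ a₁).ν (theta13OfThm1CC1 F 2 ε₀ ε₂₉ B₃ B₃' a₀ a₁).τ9.M (gOfRecord₁₃ F 2 (theta13OfThm1CC1 F 2 ε₀ ε₂₉ B₃ B₃' a₀ a₁) p) p.K n s W)) :
    ∃ θ : Stage13RParams F 2, θ.Provisos₁₃SepCoPR F 2 ∧ (θ.ZrUnity F 2 ∧ θ.SlotsNondegenerate₁₃ F 2) ∧ θ.Admissible F 2 :=
  exists_k0SepCoPR_of_exists_k0SepCoP F (exists_k0SepCoP_of_classBounds F hε hε' hB hB' ha₀ ha₁ hclass hclassC1)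

/-- **★★★★★ CUT B′ AT ⁶, AT PRINT's (2.3) DATUM** — the v1.6 K0 body for `F` from the GUARDED [15] THEOREM-1 SENTENCE `VariationalThm1RegSepCoP7MGB F 2 Adm (lamDatum F) (dataSmall7PTopOf F 2) B₃ a₀ a₁`
(k0-s1-w1 S1a-C), its guard at the witness family (`hAdm`), the β-box leaf and the guarded C¹ clause at `UbgMSCoPOfRecordB` (16c's Stage-2 re-key lifted along ★★★; cured witness).  CONDITIONAL —
the named fact is NEVER asserted. [cite: Balaban1988Convergent, Thm 1 p.262, (1.11) p.248, (2.12)–(2.13) p.256, (2.28) p.259, (3.16)–(3.22) pp.268–269; Balaban1985RegularSpaces, (1.3)–(1.9) p.77; Balaban1985Variational, (6)–(7) p.278, Thm 1 (8)–(10) p.279, p.304 lines 1–2; Balaban1984PropagatorsII, (2.3) p.224; Balaban1989LargeFieldI, (0.3)–(0.4) p.176] -/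
theorem exists_k0SepCoPR_of_thm1RegSepCoP7M_of_betaBox (F : T4Family) (hε : 0 < ε₀) (hε' : 0 < ε₂₉) (hB : 0 ≤ B₃) (hB' : 0 ≤ B₃') (ha₀ : 0 < a₀) (ha₁ : 0 < a₁) {Adm : StepGuard F}
    (h15 : VariationalThm1RegSepCoP7MGB F 2 Adm (lamDatum F) (dataSmall7PTopOf F 2) B₃ a₀ a₁)
    (hAdm : ∀ (p : B12.RunParams) (n : ℕ) (s : SeqOfRecord F (theta13OfThm1CC1 F 2 ε₀ ε₂₉ B₃ B₃' a₀ a₁).ν (theta13OfThm1CC1 F 2 ε₀ ε₂₉ B₃ B₃' a₀ a₁).τ9.M (gOfRecord₁₃ F 2 (theta13OfThm1CC1 F 2 ε₀ ε₂₉ B₃ B₃' a₀ a₁) p) p.K n), 1 ≤ n → n ≤ p.K →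
      Step.InInterval (theta13OfThm1CC1 F 2 ε₀ ε₂₉ B₃ B₃' a₀ a₁).γ n (gOfRecord₁₃ F 2 (theta13OfThm1CC1 F 2 ε₀ ε₂₉ B₃ B₃' a₀ a₁) p) → PartCompat₁₃ F 2 (theta13OfThm1CC1 F 2 ε₀ ε₂₉ B₃ B₃' a₀ a₁) p n → Adm (theta13OfThm1CC1 F 2 ε₀ ε₂₉ B₃ B₃' a₀ a₁).ν (theta13OfThm1CC1 F 2 ε₀ ε₂₉ B₃ B₃' a₀ a₁).τ9.M (gOfRecord₁₃ F 2 (theta13OfThm1CC1 F 2 ε₀ ε₂₉ B₃ B₃' a₀ a₁) p) p.K n s)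
    {b β' : ℝ} (hb : 0 ≤ b) (hlow : FlowStep.BetaLowerH b (1 / 2) (betaOfRecord₁₃ F 2 (theta13OfThm1CC1 F 2 ε₀ ε₂₉ B₃ B₃' a₀ a₁)))
    (hup : FlowStep.BetaUpperH β' (1 / 2) (betaOfRecord₁₃ F 2 (theta13OfThm1CC1 F 2 ε₀ ε₂₉ B₃ B₃' a₀ a₁))) (hβ' : β' ≤ 3)
    (hclassC1 : ∀ (p : B12.RunParams) (n : ℕ), n ≤ p.K → Step.InInterval (theta13OfThm1CC1 F 2 ε₀ ε₂₉ B₃ B₃' a₀ a₁).γ n (gOfRecord₁₃ F 2 (theta13OfThm1CC1 F 2 ε₀ ε₂₉ B₃ B₃' a₀ a₁) p) → PartCompat₁₃ F 2 (theta13OfThm1CC1 F 2 ε₀ ε₂₉ B₃ B₃' a₀ a₁) p n →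
      ∀ s : SeqOfRecord F (theta13OfThm1CC1 F 2 ε₀ ε₂₉ B₃ B₃' a₀ a₁).ν (theta13OfThm1CC1 F 2 ε₀ ε₂₉ B₃ B₃' a₀ a₁).τ9.M (gOfRecord₁₃ F 2 (theta13OfThm1CC1 F 2 ε₀ ε₂₉ B₃ B₃' a₀ a₁) p) p.K n, Sect2.SeqSeparated (theta13OfThm1CC1 F 2 ε₀ ε₂₉ B₃ B₃' a₀ a₁).ν.M₁ s → ∀ W : MSField (F.P p.K) (SU 2),
      W ∈ suppOfRecord₁₃P F 2 (theta13OfThm1CC1 F 2 ε₀ ε₂₉ B₃ B₃' a₀ a₁) p n s → Sect2.DataSmall7PTop (avOfRecord F 2 p.K) s.Ω (suppDomOfRecord F (theta13OfThm1CC1 F 2 ε₀ ε₂₉ B₃ B₃' a₀ a₁).ν p.K s.Ω) n (fun j => (theta13OfThm1CC1 F 2 ε₀ ε₂₉ B₃ B₃' a₀ a₁).s2.cR * epsOfRecord (theta13OfThm1CC1 F 2 ε₀ ε₂₉ B₃ B₃' a₀ a₁).ν (gOfRecord₁₃ F 2 (theta13OfThm1CC1 F 2 ε₀ ε₂₉ B₃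 B₃' a₀ a₁) p) j) W →
      W ∈ solvableDomB (avOfRecord F 2 p.K) (regMSCoPOfRecord F 2 (theta13OfThm1CC1 F 2 ε₀ ε₂₉ B₃ B₃' a₀ a₁).ν p.K n s.Ω) (lamBondsSeq s.Ω n) →
      ∀ m, 1 ≤ m → m ≤ n → PlaqC1SmallOn (plaqInside (s.Ω m)) (B₃' * ((theta13OfThm1CC1 F 2 ε₀ ε₂₉ B₃ B₃' a₀ a₁).s2.cR * epsOfRecord (theta13OfThm1CC1 F 2 ε₀ ε₂₉ B₃ B₃' a₀ a₁).ν (gOfRecord₁₃ F 2 (theta13OfThm1CC1 F 2 ε₀ ε₂₉ B₃ B₃' a₀ a₁) p) m) * (F.P p.K).eta m ^ 3)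
        (UbgMSCoPOfRecordB F 2 (theta13OfThm1CC1 F 2 ε₀ ε₂₉ B₃ B₃' a₀ a₁).ν (theta13OfThm1CC1 F 2 ε₀ ε₂₉ B₃ B₃' a₀ a₁).τ9.M (gOfRecord₁₃ F 2 (theta13OfThm1CC1 F 2 ε₀ ε₂₉ B₃ B₃' a₀ a₁) p) p.K n s W)) :
    ∃ θ : Stage13RParams F 2, θ.Provisos₁₃SepCoPR F 2 ∧ (θ.ZrUnity F 2 ∧ θ.SlotsNondegenerate₁₃ F 2) ∧ θ.Admissible F 2 :=
  exists_k0SepCoPR_of_exists_k0SepCoP F (exists_k0SepCoP_of_thm1RegSepCoP7M_of_betaBox F hε hε' hB hB' ha₀ ha₁ h15 hAdm hb hlow hup hβ' hclassC1)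

/-- **★★★★★★ CUT B″ AT ⁶, AT PRINT's (2.3) DATUM** — the v1.6 K0 body for `F` from BOTH guarded [15] Theorem-1 sentences over `(Adm, lamDatum F, dataSmall7PTopOf F 2)` —
`VariationalThm1RegSepCoP7MGB` ∕ `VariationalThm1C1RegSepCoP7MGB` (node00-def-K0a `Record12BgRowCoClassC1B`) — their common guard at the witness family (`hAdm`), the β-box leaf and the sign
numerics (16d's Stage-2 re-key lifted along ★★★; cured witness).  CONDITIONAL — the named facts are NEVER asserted. [cite: Balaban1988Convergent, Thm 1 p.262, (1.11) p.248, (2.12)–(2.13) p.256, (2.28) p.259, (3.16)–(3.22) pp.268–269; Balaban1985RegularSpaces, (1.3)–(1.9) p.77; Balaban1985Variational, (6)–(7) p.278, Thm 1 (8)–(10) p.279, p.304 lines 1–2; Balaban1984PropagatorsII, (2.3) p.224; Balaban1989LargeFieldI, (0.3)–(0.4) p.176] -/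
theorem exists_k0SepCoPR_of_thm1RegSepCoP7M_of_thm1C1_of_betaBox (F : T4Family) (hε : 0 < ε₀) (hε' : 0 < ε₂₉) (hB : 0 ≤ B₃) (hB' : 0 ≤ B₃') (ha₀ : 0 < a₀) (ha₁ : 0 < a₁) {Adm : StepGuard F}
    (h15 : VariationalThm1RegSepCoP7MGB F 2 Adm (lamDatum F) (dataSmall7PTopOf F 2) B₃ a₀ a₁) (h15C1 : VariationalThm1C1RegSepCoP7MGB F 2 Adm (lamDatum F) (dataSmall7PTopOf F 2) B₃ B₃' a₀ a₁)
    (hAdm : ∀ (p : B12.RunParams) (n : ℕ) (s : SeqOfRecord F (theta13OfThm1CC1 F 2 ε₀ ε₂₉ B₃ B₃' a₀ a₁).ν (theta13OfThm1CC1 F 2 ε₀ ε₂₉ B₃ B₃' a₀ a₁).τ9.M (gOfRecord₁₃ F 2 (theta13OfThm1CC1 F 2 ε₀ ε₂₉ B₃ B₃' a₀ a₁) p) p.K n), 1 ≤ n → n ≤ p.K →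
      Step.InInterval (theta13OfThm1CC1 F 2 ε₀ ε₂₉ B₃ B₃' a₀ a₁).γ n (gOfRecord₁₃ F 2 (theta13OfThm1CC1 F 2 ε₀ ε₂₉ B₃ B₃' a₀ a₁) p) → PartCompat₁₃ F 2 (theta13OfThm1CC1 F 2 ε₀ ε₂₉ B₃ B₃' a₀ a₁) p n → Adm (theta13OfThm1CC1 F 2 ε₀ ε₂₉ B₃ B₃' a₀ a₁).ν (theta13OfThm1CC1 F 2 ε₀ ε₂₉ B₃ B₃' a₀ a₁).τ9.M (gOfRecord₁₃ F 2 (theta13OfThm1CC1 F 2 ε₀ ε₂₉ B₃ B₃' a₀ a₁) p) p.K n s)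
    {b β' : ℝ} (hb : 0 ≤ b) (hlow : FlowStep.BetaLowerH b (1 / 2) (betaOfRecord₁₃ F 2 (theta13OfThm1CC1 F 2 ε₀ ε₂₉ B₃ B₃' a₀ a₁)))
    (hup : FlowStep.BetaUpperH β' (1 / 2) (betaOfRecord₁₃ F 2 (theta13OfThm1CC1 F 2 ε₀ ε₂₉ B₃ B₃' a₀ a₁))) (hβ' : β' ≤ 3) :
    ∃ θ : Stage13RParams F 2, θ.Provisos₁₃SepCoPR F 2 ∧ (θ.ZrUnity F 2 ∧ θ.SlotsNondegenerate₁₃ F 2) ∧ θ.Admissible F 2 :=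
  exists_k0SepCoPR_of_exists_k0SepCoP F (exists_k0SepCoP_of_thm1RegSepCoP7M_of_thm1C1_of_betaBox F hε hε' hB hB' ha₀ ha₁ h15 h15C1 hAdm hb hlow hup hβ')

end Pointed

end Literature.MathematicalPhysics.QuantumFieldTheory.Balaban1983to89.Node00

end
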